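import Mathlib
import HarnessLib

/-!
# ValiantsHypothesis / SymPencil — crux `EquivariantSdcNotQP` (stmt-ValiantsHypothesis-17792), line
# `birth_EquivariantSdcNotQP`, open piece (ii′) `FiniteConjugationLift` of `stub_permify`
# (see `…PermifyReduction.lean`): PART A — restricted determinants of an endomorphism / a pencil
# on the lattice of invariant subspaces

Toolkit for the composition-factor reduction of a conjugation-equivariant pencil (the intended
route to (ii′) recorded in `SymPencilEquivariantSdcNotQPPermifyReduction.lean`), helper of the item
(`--supports stmt-ValiantsHypothesis-17792 --as helper`; no definitions, no named facts).

Linear algebra over any field `K`, `V` finite-dimensional, `T : V →ₗ V`, `W, W₁, W₂ ≤ V` invariant: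
* `restrict_eq_retraction_comp` — `T|_W = π ∘ T ∘ ι` for any linear retraction `π` of `ι : W ↪ V`;
* `det_restrict_restrict` — restricting to `W` then to `W' ≤ W` has the determinant of `T|_{W'}`;
* `det_mapQ_eq_det_compression`, `det_eq_det_restrict_mul_det_compression` — the map induced on
  `V ⧸ W` has the determinant of the compression of `T` to any complement of `W`, so
  `det T = det T|_W · det (compression)` (Mathlib's `LinearMap.det_eq_det_mul_det`);
* `det_restrict_sup_mul_inf` — **`det T|_{W₁+W₂} · det T|_{W₁∩W₂} = det T|_{W₁} · det T|_{W₂}`**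
  (second isomorphism theorem `LinearMap.quotientInfEquivSupQuotient` intertwines the induced maps);
* `map_le_comap_of_conj`, `det_restrict_map_of_conj` — if `T G = G T'` then `G` carries
  `T'`-invariant subspaces to `T`-invariant ones with the same restricted determinant;
* `det_restrict_congr`, `sup_le_comap_of`, `inf_le_comap_of` — bookkeeping.
Pencils `B : Matrix (Fin m) (Fin m) (MvPolynomial σ ℂ)` acting by `B(a) := toLin' (B.map (eval a))`:
* `compression_map_eval`, `eval_det_compression` — the constant-sandwiched matrix `[π] B [ι]`
  evaluates to the matrix of `π ∘ B(a) ∘ ι`, so `det (π ∘ B(a) ∘ ι)` is a POLYNOMIAL function of `a`;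
* `exists_poly_det_restrict`, `exists_poly_det_compression` — hence `a ↦ det (B(a)|_W)` (for `W`
  invariant under every `B(a)`) and compression determinants are represented by polynomials;
* `det_restrict_top`, `det_restrict_bot`, `map_rename_map_eval` — `P_⊤ = det B`, `P_⊥ = 1`,
  `B(a ∘ f) = (B.map (rename f))(a)`.

Honest framing: infrastructure only; (ii′), `stub_permify`, the crux and `VP ≠ VNP` remain OPEN and
nothing here is progress on them.
-/

noncomputable section

set_option linter.dupNamespace false

namespace Summit.ValiantsHypothesis.ValiantsHypothesis.Theorems.SymPencilEquivariantSdcNotQP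

open Module Submodule

section LinearAlgebra

variable {K : Type*} [Field K] {V : Type*} [AddCommGroup V] [Module K V] [FiniteDimensional K V]

/-! ### Restrictions -/

omit [FiniteDimensional K V] in
/-- A restriction to an invariant subspace is the compression `π ∘ T ∘ ι` for ANY linear retraction
`π` of the inclusion `ι`. [folklore] -/
theorem restrict_eq_retraction_comp (T : V →ₗ[K] V) {W : Submodule K V} (hW : W ≤ W.comap T)
    (π : V →ₗ[K] W) (hπ : π ∘ₗ W.subtype = LinearMap.id) :
    T.restrict hW = π ∘ₗ T ∘ₗ W.subtype := by
  ext w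
  have hTw : T w ∈ W := hW w.2
  have h := LinearMap.congr_fun hπ ⟨T w, hTw⟩
  simp only [LinearMap.coe_comp, Submodule.coe_subtype, Function.comp_apply, LinearMap.id_coe,
    id_eq] at h
  simp only [LinearMap.coe_comp, Function.comp_apply, Submodule.coe_subtype, h,
    LinearMap.coe_restrict_apply]

omit [FiniteDimensional K V] in
/-- Restricting first to `W` and then to `W' ≤ W` (pulled back into `W`) has the determinant of
the restriction to `W'`. [folklore] -/
theorem det_restrict_restrict (T : V →ₗ[K] V) {W W' : Submodule K V} (hW : W ≤ W.comap T)
    (hW' : W' ≤ W'.comap T) (hle : W' ≤ W)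
    (h : W'.comap W.subtype ≤ (W'.comap W.subtype).comap (T.restrict hW)) :
    LinearMap.det ((T.restrict hW).restrict h) = LinearMap.det (T.restrict hW') := by
  set e : ↥(W'.comap W.subtype) ≃ₗ[K] ↥W' := Submodule.comapSubtypeEquivOfLe hle with he
  have key : T.restrict hW' = e.toLinearMap ∘ₗ (T.restrict hW).restrict h ∘ₗ e.symm.toLinearMap := by
    ext x
    simp [he, Submodule.comapSubtypeEquivOfLe, LinearMap.coe_restrict_apply]
  rw [key, LinearMap.det_conj]

/-! ### Quotients and compressions -/

omit [FiniteDimensional K V] in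
/-- The map induced on `V ⧸ W` by `T` has the determinant of the compression of `T` to any
complement `C` of `W` (projection onto `C` along `W`). [folklore] -/
theorem det_mapQ_eq_det_compression (T : V →ₗ[K] V) {W C : Submodule K V} (hW : W ≤ W.comap T)
    (hWC : IsCompl W C) :
    LinearMap.det (W.mapQ W T hW) =
      LinearMap.det (C.projectionOnto W hWC.symm ∘ₗ T ∘ₗ C.subtype) := by
  set e : (V ⧸ W) ≃ₗ[K] C := W.quotientEquivOfIsCompl C hWC with he
  have key : C.projectionOnto W hWC.symm ∘ₗ T ∘ₗ C.subtype =
      e.toLinearMap ∘ₗ W.mapQ W T hW ∘ₗ e.symm.toLinearMap := by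
    ext c
    simp [he, Submodule.mapQ_apply]
  rw [key, LinearMap.det_conj]

/-- `det T = det (T|_W) · det (compression to a complement)`. [folklore] -/
theorem det_eq_det_restrict_mul_det_compression (T : V →ₗ[K] V) {W C : Submodule K V}
    (hW : W ≤ W.comap T) (hWC : IsCompl W C) :
    LinearMap.det T =
      LinearMap.det (T.restrict hW) * LinearMap.det (C.projectionOnto W hWC.symm ∘ₗ T ∘ₗ C.subtype) := by
  rw [← det_mapQ_eq_det_compression T hW hWC]
  exact LinearMap.det_eq_det_mul_det W T hW

/-! ### The lattice identity -/

/-- **Second isomorphism theorem, determinant form.**  For `T`-invariant subspaces `W₁, W₂`: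
`det T|_{W₁ + W₂} · det T|_{W₁ ∩ W₂} = det T|_{W₁} · det T|_{W₂}`. [folklore] -/
theorem det_restrict_sup_mul_inf (T : V →ₗ[K] V) {W₁ W₂ : Submodule K V}
    (h₁ : W₁ ≤ W₁.comap T) (h₂ : W₂ ≤ W₂.comap T)
    (hsup : W₁ ⊔ W₂ ≤ (W₁ ⊔ W₂).comap T) (hinf : W₁ ⊓ W₂ ≤ (W₁ ⊓ W₂).comap T) :
    LinearMap.det (T.restrict hsup) * LinearMap.det (T.restrict hinf) =
      LinearMap.det (T.restrict h₁) * LinearMap.det (T.restrict h₂) := by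
  -- the two filtrations `W₂ ≤ W₁ ⊔ W₂` and `W₁ ⊓ W₂ ≤ W₁`
  set A₂ : Submodule K ↥(W₁ ⊔ W₂) := W₂.comap (W₁ ⊔ W₂).subtype with hA₂
  set A₁ : Submodule K ↥W₁ := (W₁ ⊓ W₂).comap W₁.subtype with hA₁
  have hA₂inv : A₂ ≤ A₂.comap (T.restrict hsup) := by
    intro x hx
    simp only [hA₂, Submodule.mem_comap, Submodule.coe_subtype, LinearMap.coe_restrict_apply] at hx ⊢
    exact h₂ hx
  have hA₁inv : A₁ ≤ A₁.comap (T.restrict h₁) := by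
    intro x hx
    simp only [hA₁, Submodule.mem_comap, Submodule.coe_subtype, LinearMap.coe_restrict_apply] at hx ⊢
    exact hinf hx
  have e₂ := LinearMap.det_eq_det_mul_det A₂ (T.restrict hsup) hA₂inv
  have e₁ := LinearMap.det_eq_det_mul_det A₁ (T.restrict h₁) hA₁inv
  rw [det_restrict_restrict T hsup h₂ le_sup_right] at e₂
  rw [det_restrict_restrict T h₁ hinf inf_le_left] at e₁
  -- the second isomorphism `W₁ / (W₁ ∩ W₂) ≃ (W₁ + W₂) / W₂` intertwines the induced maps
  set e : (↥W₁ ⧸ A₁) ≃ₗ[K] (↥(W₁ ⊔ W₂) ⧸ A₂) := LinearMap.quotientInfEquivSupQuotient W₁ W₂ with he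
  have hnat : A₁.mapQ A₁ (T.restrict h₁) hA₁inv =
      e.symm.toLinearMap ∘ₗ A₂.mapQ A₂ (T.restrict hsup) hA₂inv ∘ₗ e.symm.symm.toLinearMap := by
    refine Submodule.linearMap_qext _ (LinearMap.ext fun x => ?_)
    have hx : e (Submodule.Quotient.mk x) =
        Submodule.Quotient.mk (Submodule.inclusion (le_sup_left : W₁ ≤ W₁ ⊔ W₂) x) := rfl
    have hTx : e (Submodule.Quotient.mk (T.restrict h₁ x)) =
        Submodule.Quotient.mk (Submodule.inclusion (le_sup_left : W₁ ≤ W₁ ⊔ W₂) (T.restrict h₁ x)) :=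
      rfl
    have hincl : Submodule.inclusion (le_sup_left : W₁ ≤ W₁ ⊔ W₂) (T.restrict h₁ x) =
        T.restrict hsup (Submodule.inclusion (le_sup_left : W₁ ≤ W₁ ⊔ W₂) x) := by
      apply Subtype.ext
      simp
    simp only [LinearMap.coe_comp, Function.comp_apply, Submodule.mkQ_apply, Submodule.mapQ_apply,
      LinearEquiv.coe_coe]
    rw [LinearEquiv.symm_symm, hx, Submodule.mapQ_apply, ← hincl, ← hTx, LinearEquiv.symm_apply_apply]
  have hdetQ : LinearMap.det (A₁.mapQ A₁ (T.restrict h₁) hA₁inv) =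
      LinearMap.det (A₂.mapQ A₂ (T.restrict hsup) hA₂inv) := by
    rw [hnat]
    have := LinearMap.det_conj (A₂.mapQ A₂ (T.restrict hsup) hA₂inv) e.symm
    simpa using this
  rw [e₂, e₁, hdetQ]
  ring

/-! ### Transport under conjugation -/

omit [FiniteDimensional K V] in
/-- If `T G = G T'` then `G` maps `T'`-invariant subspaces to `T`-invariant ones. [folklore] -/
theorem map_le_comap_of_conj (T T' : V →ₗ[K] V) (G : V ≃ₗ[K] V)
    (hTG : T ∘ₗ (G : V →ₗ[K] V) = (G : V →ₗ[K] V) ∘ₗ T') {W : Submodule K V}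
    (hW : W ≤ W.comap T') : W.map (G : V →ₗ[K] V) ≤ (W.map (G : V →ₗ[K] V)).comap T := by
  rintro _ ⟨w, hw, rfl⟩
  refine Submodule.mem_comap.2 ⟨T' w, hW hw, ?_⟩
  have := LinearMap.congr_fun hTG w
  simpa using this.symm

omit [FiniteDimensional K V] in
/-- … and the restricted determinants agree: `det T|_{G W} = det T'|_W`. [folklore] -/
theorem det_restrict_map_of_conj (T T' : V →ₗ[K] V) (G : V ≃ₗ[K] V)
    (hTG : T ∘ₗ (G : V →ₗ[K] V) = (G : V →ₗ[K] V) ∘ₗ T') {W : Submodule K V}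
    (hW : W ≤ W.comap T') (hGW : W.map (G : V →ₗ[K] V) ≤ (W.map (G : V →ₗ[K] V)).comap T) :
    LinearMap.det (T.restrict hGW) = LinearMap.det (T'.restrict hW) := by
  set e : ↥W ≃ₗ[K] ↥(W.map (G : V →ₗ[K] V)) :=
    Submodule.equivMapOfInjective (G : V →ₗ[K] V) G.injective W with he
  have key : T.restrict hGW = e.toLinearMap ∘ₗ T'.restrict hW ∘ₗ e.symm.toLinearMap := by
    ext y
    obtain ⟨w, rfl⟩ := e.surjective y
    have := LinearMap.congr_fun hTG w
    simp only [LinearMap.coe_comp, LinearEquiv.coe_coe, Function.comp_apply] at this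
    simp [he, LinearMap.coe_restrict_apply, this]
  rw [key, LinearMap.det_conj]

end LinearAlgebra

/-! ### Pencils: the restricted determinants are polynomial -/

section Pencil

open MvPolynomial Matrix

variable {σ : Type*} {m : ℕ}

/-- Evaluating the compression `[π] B [ι]` of a matrix pencil at a point gives the matrix of
`π ∘ B(a) ∘ ι`. [folklore] -/
theorem compression_map_eval (B : Matrix (Fin m) (Fin m) (MvPolynomial σ ℂ))
    {U : Type*} [AddCommGroup U] [Module ℂ U] {k : ℕ} (bU : Basis (Fin k) ℂ U)
    (π : (Fin m → ℂ) →ₗ[ℂ] U) (ι : U →ₗ[ℂ] (Fin m → ℂ)) (a : σ → ℂ) :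
    ((LinearMap.toMatrix (Pi.basisFun ℂ (Fin m)) bU π).map (MvPolynomial.C : ℂ →+* MvPolynomial σ ℂ) *
        B * (LinearMap.toMatrix bU (Pi.basisFun ℂ (Fin m)) ι).map
          (MvPolynomial.C : ℂ →+* MvPolynomial σ ℂ)).map (MvPolynomial.eval a) =
      LinearMap.toMatrix bU bU (π ∘ₗ Matrix.toLin' (B.map (MvPolynomial.eval a)) ∘ₗ ι) := by
  have hC : ∀ {l l' : ℕ} (M : Matrix (Fin l) (Fin l') ℂ),
      (M.map (MvPolynomial.C : ℂ →+* MvPolynomial σ ℂ)).map (MvPolynomial.eval a) = M := by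
    intro l l' M
    ext i j
    simp
  rw [Matrix.map_mul, Matrix.map_mul, hC, hC, LinearMap.toMatrix_comp bU (Pi.basisFun ℂ (Fin m)) bU,
    LinearMap.toMatrix_comp bU (Pi.basisFun ℂ (Fin m)) (Pi.basisFun ℂ (Fin m)),
    ← Matrix.toLin_eq_toLin', LinearMap.toMatrix_toLin, Matrix.mul_assoc]

/-- Hence `det (π ∘ B(a) ∘ ι)` is a polynomial function of `a`, represented by
`det ([π] B [ι])`. [folklore] -/
theorem eval_det_compression (B : Matrix (Fin m) (Fin m) (MvPolynomial σ ℂ))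
    {U : Type*} [AddCommGroup U] [Module ℂ U] {k : ℕ} (bU : Basis (Fin k) ℂ U)
    (π : (Fin m → ℂ) →ₗ[ℂ] U) (ι : U →ₗ[ℂ] (Fin m → ℂ)) (a : σ → ℂ) :
    MvPolynomial.eval a ((LinearMap.toMatrix (Pi.basisFun ℂ (Fin m)) bU π).map
        (MvPolynomial.C : ℂ →+* MvPolynomial σ ℂ) * B *
        (LinearMap.toMatrix bU (Pi.basisFun ℂ (Fin m)) ι).map
          (MvPolynomial.C : ℂ →+* MvPolynomial σ ℂ)).det =
      LinearMap.det (π ∘ₗ Matrix.toLin' (B.map (MvPolynomial.eval a)) ∘ₗ ι) := by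
  rw [RingHom.map_det, RingHom.mapMatrix_apply, compression_map_eval, LinearMap.det_toMatrix]

/-- **Restricted determinants of a pencil are polynomial.**  If `W` is invariant under every
`B(a)`, there is a polynomial `P_W` with `P_W(a) = det (B(a)|_W)` for all `a`. [folklore] -/
theorem exists_poly_det_restrict (B : Matrix (Fin m) (Fin m) (MvPolynomial σ ℂ))
    {W : Submodule ℂ (Fin m → ℂ)}
    (hW : ∀ a : σ → ℂ, W ≤ W.comap (Matrix.toLin' (B.map (MvPolynomial.eval a)))) :
    ∃ P : MvPolynomial σ ℂ, ∀ a : σ → ℂ,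
      MvPolynomial.eval a P = LinearMap.det ((Matrix.toLin' (B.map (MvPolynomial.eval a))).restrict (hW a)) := by
  obtain ⟨π, hπ⟩ := W.subtype.exists_leftInverse_of_injective W.ker_subtype
  refine ⟨((LinearMap.toMatrix (Pi.basisFun ℂ (Fin m)) (Module.finBasis ℂ W) π).map
        (MvPolynomial.C : ℂ →+* MvPolynomial σ ℂ) * B *
        (LinearMap.toMatrix (Module.finBasis ℂ W) (Pi.basisFun ℂ (Fin m)) W.subtype).map
          (MvPolynomial.C : ℂ →+* MvPolynomial σ ℂ)).det, fun a => ?_⟩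
  rw [eval_det_compression, restrict_eq_retraction_comp _ (hW a) π hπ]

/-- The determinant of the compression of a pencil to a complement `C` of an invariant `W` is a
polynomial function (represented by `det ([π_C] B [ι_C])`). [folklore] -/
theorem exists_poly_det_compression (B : Matrix (Fin m) (Fin m) (MvPolynomial σ ℂ))
    {U : Type*} [AddCommGroup U] [Module ℂ U] [FiniteDimensional ℂ U]
    (π : (Fin m → ℂ) →ₗ[ℂ] U) (ι : U →ₗ[ℂ] (Fin m → ℂ)) :
    ∃ P : MvPolynomial σ ℂ, ∀ a : σ → ℂ,
      MvPolynomial.eval a P = LinearMap.det (π ∘ₗ Matrix.toLin' (B.map (MvPolynomial.eval a)) ∘ₗ ι) :=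
  ⟨_, fun a => eval_det_compression B (Module.finBasis ℂ U) π ι a⟩

/-- The whole space: `det (B(a)|_⊤) = (det B)(a)`. [folklore] -/
theorem det_restrict_top (B : Matrix (Fin m) (Fin m) (MvPolynomial σ ℂ)) (a : σ → ℂ)
    (h : (⊤ : Submodule ℂ (Fin m → ℂ)) ≤ (⊤ : Submodule ℂ (Fin m → ℂ)).comap
      (Matrix.toLin' (B.map (MvPolynomial.eval a)))) :
    LinearMap.det ((Matrix.toLin' (B.map (MvPolynomial.eval a))).restrict h) =
      MvPolynomial.eval a B.det := by
  set T := Matrix.toLin' (B.map (MvPolynomial.eval a)) with hT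
  set e : (Fin m → ℂ) ≃ₗ[ℂ] (⊤ : Submodule ℂ (Fin m → ℂ)) := Submodule.topEquiv.symm with he
  have key : T.restrict h = e.toLinearMap ∘ₗ T ∘ₗ e.symm.toLinearMap := by
    ext x
    simp [he, LinearMap.coe_restrict_apply]
  rw [key, LinearMap.det_conj, hT, LinearMap.det_toLin', RingHom.map_det, RingHom.mapMatrix_apply]

/-- The zero space: `det (B(a)|_⊥) = 1`. [folklore] -/
theorem det_restrict_bot (B : Matrix (Fin m) (Fin m) (MvPolynomial σ ℂ)) (a : σ → ℂ)
    (h : (⊥ : Submodule ℂ (Fin m → ℂ)) ≤ (⊥ : Submodule ℂ (Fin m → ℂ)).comap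
      (Matrix.toLin' (B.map (MvPolynomial.eval a)))) :
    LinearMap.det ((Matrix.toLin' (B.map (MvPolynomial.eval a))).restrict h) = 1 :=
  LinearMap.det_eq_one_of_subsingleton _

/-- Renaming variables and evaluating: `B(x ∘ f)` is the evaluation of `B.map (rename f)`.
[folklore] -/
theorem map_rename_map_eval {τ : Type*} (B : Matrix (Fin m) (Fin m) (MvPolynomial σ ℂ))
    (f : σ → τ) (a : τ → ℂ) :
    (B.map (MvPolynomial.rename f)).map (MvPolynomial.eval a) = B.map (MvPolynomial.eval (a ∘ f)) := by
  ext i j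
  simp [MvPolynomial.eval_rename]

end Pencil

end Summit.ValiantsHypothesis.ValiantsHypothesis.Theorems.SymPencilEquivariantSdcNotQP

end
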